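import Mathlib
import HarnessLib
import Summits.HubbardSuperconductivity.HubbardSuperconductivity.Theorems.KLProgrammeKLRegimeSplitPhValueExchangeShifts
import Summits.HubbardSuperconductivity.HubbardSuperconductivity.Theorems.KLProgrammeMatsubaraPairWeightFrame
import Summits.HubbardSuperconductivity.HubbardSuperconductivity.Theorems.KLProgrammeKLRegimeEngineTwoShellLatticeMassSharp

/-!
# Route `KLProgramme` — ENGINE (stmt-HubbardSuperconductivity-20437 `KLRegimeEngineV17F2`), row (c) binder #8 (★ v19 `hexLadMV`), EXCHANGE row `RQ`: the three closer-side DATA of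
# `klph_exchangeRow_diag_le_of_moduli` DISCHARGED — the shifted rung `G₊ = 4/Λ(t)` above the thermal layer, the member symbol's frequency modulus `εΦ = (128/Λ(t)²)·q₀·(2Λ(t) + q₀)`,
# and the hard-shell count `N_sh ≤ (Λ(t)β/π + 1)·(2200·4Λₙ·L² + 200000·L)` — brick O6h-c
# (cell gate-hubbard-kl, seat hubbard-kl-k3c2-p2 g32, technique «thermal-bar induction n ≤ nScales β + 1 with EngineBoundsAtV4S sums»)

WHY.  O6h-b (`…SplitPhValueExchangeBound`) bounds the exchange row at its diagonal by rotation + moduli + a one-more-rung correction whose data `G₊` (norm of the frequency-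
shifted rung on the hard shell), `εΦ` (variation of the member symbol under the shift) and `N_sh = #{p : Ẇ_t(p) ≠ 0}` were left to the consumer.  Here they are, from the hard
shell `Λ²/4 ≤ ω² + e² ≤ Λ²` alone:

* `klph_shift_sq_ge_of_shell` — `Ẇ_Λ(p) ≠ 0`, `|ω′ − ω_p| ≤ q₀`, `8q₀ ≤ Λ` ⇒ `Λ²/16 ≤ ω′² + e_p²` (either `|e| ≥ Λ/4`, or `|ω| ≥ 2Λ/5` and `|ω′| ≥ 2Λ/5 − Λ/8 > Λ/4`);
  hence `klph_norm_propCT_shift_le` — `‖ĝ_K(ω′, k̃)‖ ≤ 4/Λ` (the datum `G₊`; `8q₀ = 16π/β ≤ Λ(t)` holds for `n ≤ n_β − 2`, the last scales take `G₊ = β/π`).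
* `klph_klPhi_local_lipschitz` — for `0 < Λ_j ≤ Λ`, `Λ²/4 ≤ s`, `Λ²/16 ≤ s′`: `|klPhi Λ_j Λ s′ − klPhi Λ_j Λ s| ≤ (128/Λ²)|s′ − s|` (if `Λ_j ≥ Λ/4` the global constant `8/Λ_j²`
  of `klPhi_lipschitz`; else `χ₂(·/Λ_j²) = 1` at both points — `salmhoferCutoff_of_ge` — and only `χ₂(·/Λ²)` moves, `4/Λ²`); hence `klph_memberSymbol_shift_le` —
  `|Φ_j(t)(ω′,k̃) − Φ_j(t)(ω,k̃)| ≤ (128/Λ(t)²)·q₀·(2Λ(t) + q₀)` on the hard shell (the datum `εΦ`).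
* `klph_card_hardShell_le` — `#{p : Ẇ_t(p) ≠ 0} ≤ (Λ(t)β/π + 1)·(2200·(4Λₙ)·L² + 200000·L)` on an admissible frame with `L ≥ 2¹⁵`, `1 ≤ n` (`card_disc_filter_le_sharp` ×
  `klzf_card_shell_le`) (the datum `N_sh`).
Pure real analysis/counting over landed rows; no definitions; nothing asserts (c), K3 or superconductivity.  [cite: BenfattoGiulianiMastropietro2006, §2.5]
-/

noncomputable section

namespace Summit.HubbardSuperconductivity.HubbardSuperconductivity.Theorems.KLRegimeSplit

set_option linter.dupNamespace false -- summit = problem name (single-conjunct summit), D-0017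

open Real Set Finset Literature.MathematicalPhysics.QuantumLattice
open Literature.Probability.LatticeModels hiding torusSupNorm
open Summit.HubbardSuperconductivity.HubbardSuperconductivity.Theorems.TwoPointAssembly
open Summit.HubbardSuperconductivity.HubbardSuperconductivity.Theorems.KLProgrammeLegKernels
open Summit.HubbardSuperconductivity.HubbardSuperconductivity.Theorems.KLRegimeWick
open Summit.HubbardSuperconductivity.HubbardSuperconductivity.Theorems.EngineV8
open Summit.HubbardSuperconductivity.HubbardSuperconductivity.Theorems.DispersionFlow

variable {L M : ℕ} [NeZero L] [NeZero M]

/-! ## §1 The shifted rung on the hard shell -/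

omit [NeZero L] [NeZero M] in
/-- On the hard shell: `Λ²/4 ≤ ω² + e² ≤ Λ²` (`Ẇ_Λ(p) ≠ 0`, `Λ ≠ 0`). -/
theorem klph_shell_of_derivWeight_ne_zero (β μ : ℝ) (K : TrigPolyC4v) {Λ : ℝ} (hΛ : Λ ≠ 0) {p : FreqMomentum L M}
    (hp : deriv (fun Λ' : ℝ => hubbardCutoffWeightCT L M β μ K Λ' p) Λ ≠ 0) :
    Λ ^ 2 / 4 ≤ matsubaraFreq β M p.1 ^ 2 + nambuXiCT L μ K p.2 ^ 2 ∧ matsubaraFreq β M p.1 ^ 2 + nambuXiCT L μ K p.2 ^ 2 ≤ Λ ^ 2 := by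
  by_contra h
  rw [not_and_or, not_le, not_le] at h
  exact hp (klws_deriv_cutoffWeight_scale_eq_zero L M β μ K hΛ p h)

omit [NeZero L] [NeZero M] in
/-- **The shifted label stays on a comparable shell**: `Ẇ_Λ(p) ≠ 0`, `|ω′ − ω_p| ≤ q₀`, `8q₀ ≤ Λ` ⇒ `Λ²/16 ≤ ω′² + e_p²`. -/
theorem klph_shift_sq_ge_of_shell (β μ : ℝ) (K : TrigPolyC4v) {Λ : ℝ} (hΛ : 0 < Λ) {p : FreqMomentum L M}
    (hp : deriv (fun Λ' : ℝ => hubbardCutoffWeightCT L M β μ K Λ' p) Λ ≠ 0) {ω' q₀ : ℝ} (hq : |ω' - matsubaraFreq β M p.1| ≤ q₀) (h8 : 8 * q₀ ≤ Λ) :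
    Λ ^ 2 / 16 ≤ ω' ^ 2 + nambuXiCT L μ K p.2 ^ 2 := by
  obtain ⟨hlo, -⟩ := klph_shell_of_derivWeight_ne_zero β μ K hΛ.ne' hp
  set ω := matsubaraFreq β M p.1
  set e := nambuXiCT L μ K p.2
  by_cases he : Λ ^ 2 / 16 ≤ e ^ 2
  · nlinarith [sq_nonneg ω']
  · push Not at he
    have hω2 : 3 * Λ ^ 2 / 16 ≤ ω ^ 2 := by linarith
    -- `|ω| ≥ 2Λ/5`
    have hωabs : 2 * Λ / 5 ≤ |ω| := by
      by_contra h
      push Not at h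
      have h0 : 0 ≤ |ω| := abs_nonneg _
      have : |ω| ^ 2 < (2 * Λ / 5) ^ 2 := by exact pow_lt_pow_left₀ h h0 two_ne_zero
      rw [sq_abs] at this
      nlinarith
    -- `|ω′| ≥ |ω| − q₀ ≥ 2Λ/5 − Λ/8 > Λ/4`
    have hω'abs : Λ / 4 ≤ |ω'| := by
      have h1 : |ω| - |ω' - ω| ≤ |ω'| := by
        have := abs_sub_abs_le_abs_sub ω ω'
        rw [abs_sub_comm] at this
        linarith
      linarith
    have : (Λ / 4) ^ 2 ≤ ω' ^ 2 := by
      rw [← sq_abs ω']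
      exact pow_le_pow_left₀ (by positivity) hω'abs 2
    nlinarith [sq_nonneg e]

omit [NeZero L] [NeZero M] in
/-- **The shifted rung on the hard shell** (the datum `G₊` of `klph_exchangeRow_diag_le_of_moduli` above the thermal layer):
`Ẇ_Λ(p) ≠ 0`, `|ω_ν′ − ω_p| ≤ q₀`, `8q₀ ≤ Λ` ⇒ `‖ĝ_K(ν′, k̃_p)‖ ≤ 4/Λ`. -/
theorem klph_norm_propCT_shift_le (β μ : ℝ) (K : TrigPolyC4v) {Λ : ℝ} (hΛ : 0 < Λ) {p : FreqMomentum L M}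
    (hp : deriv (fun Λ' : ℝ => hubbardCutoffWeightCT L M β μ K Λ' p) Λ ≠ 0) {ν' : MatsubaraIdx M} {q₀ : ℝ}
    (hq : |matsubaraFreq β M ν' - matsubaraFreq β M p.1| ≤ q₀) (h8 : 8 * q₀ ≤ Λ) :
    ‖propCT L M β μ K (ν', p.2)‖ ≤ 4 / Λ := by
  have hs := klph_shift_sq_ge_of_shell β μ K hΛ hp hq h8
  rw [norm_propCT_eq]
  have hsqrt : Λ / 4 ≤ Real.sqrt (matsubaraFreq β M ν' ^ 2 + nambuXiCT L μ K p.2 ^ 2) := by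
    rw [show Λ / 4 = Real.sqrt ((Λ / 4) ^ 2) from (Real.sqrt_sq (by positivity)).symm]
    exact Real.sqrt_le_sqrt (by linarith)
  calc (Real.sqrt (matsubaraFreq β M ν' ^ 2 + nambuXiCT L μ K p.2 ^ 2))⁻¹ ≤ (Λ / 4)⁻¹ := inv_anti₀ (by positivity) hsqrt
    _ = 4 / Λ := by rw [inv_div]

/-! ## §2 The member symbol under the frequency shift -/

omit [NeZero L] [NeZero M] in
/-- **Local Lipschitz modulus of the member symbol on the hard shell**: `0 < Λ_j ≤ Λ`, `Λ²/4 ≤ s`, `Λ²/16 ≤ s′` ⇒ `|klPhi Λ_j Λ s′ − klPhi Λ_j Λ s| ≤ (128/Λ²)·|s′ − s|`. -/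
theorem klph_klPhi_local_lipschitz {Λj Λ : ℝ} (hΛj : 0 < Λj) (hle : Λj ≤ Λ) {s s' : ℝ} (hs : Λ ^ 2 / 4 ≤ s) (hs' : Λ ^ 2 / 16 ≤ s') :
    |klPhi Λj Λ s' - klPhi Λj Λ s| ≤ 128 / Λ ^ 2 * |s' - s| := by
  have hΛ : 0 < Λ := hΛj.trans_le hle
  have hΛ2 : 0 < Λ ^ 2 := by positivity
  by_cases hj : Λ / 4 ≤ Λj
  · -- global constant `8/Λ_j² ≤ 128/Λ²`
    have h := klPhi_lipschitz hΛj hle s' s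
    have hc : 8 / Λj ^ 2 ≤ 128 / Λ ^ 2 := by
      rw [div_le_div_iff₀ (by positivity) hΛ2]
      have : Λ ^ 2 ≤ (4 * Λj) ^ 2 := pow_le_pow_left₀ hΛ.le (by linarith) 2
      nlinarith
    exact h.trans (mul_le_mul_of_nonneg_right hc (abs_nonneg _))
  · -- deep member: `χ₂(s/Λ_j²) = χ₂(s′/Λ_j²) = 1`, only `χ₂(·/Λ²)` moves
    push Not at hj
    have hj2 : 0 < Λj ^ 2 := by positivity
    have hΛj2 : Λj ^ 2 < Λ ^ 2 / 16 := by
      have : (4 * Λj) ^ 2 < Λ ^ 2 := pow_lt_pow_left₀ (by linarith) (by positivity) two_ne_zero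
      nlinarith
    have h1 : 1 ≤ s / Λj ^ 2 := by rw [le_div_iff₀ hj2]; linarith
    have h1' : 1 ≤ s' / Λj ^ 2 := by rw [le_div_iff₀ hj2]; linarith
    unfold klPhi
    rw [salmhoferCutoff_of_ge h1, salmhoferCutoff_of_ge h1']
    have h2 := salmhoferCutoff_lipschitz_four (s' / Λ ^ 2) (s / Λ ^ 2)
    have e2 : |s' / Λ ^ 2 - s / Λ ^ 2| = (Λ ^ 2)⁻¹ * |s' - s| := by rw [← sub_div, abs_div, abs_of_pos hΛ2]; ring
    rw [e2] at h2
    rw [show (1 : ℝ) - salmhoferCutoff (s' / Λ ^ 2) - (1 - salmhoferCutoff (s / Λ ^ 2)) = -(salmhoferCutoff (s' / Λ ^ 2) - salmhoferCutoff (s / Λ ^ 2)) by ring,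
      abs_neg]
    calc |salmhoferCutoff (s' / Λ ^ 2) - salmhoferCutoff (s / Λ ^ 2)| ≤ 4 * ((Λ ^ 2)⁻¹ * |s' - s|) := h2
      _ = 4 / Λ ^ 2 * |s' - s| := by ring
      _ ≤ 128 / Λ ^ 2 * |s' - s| := by gcongr; norm_num

omit [NeZero L] [NeZero M] in
/-- **The member symbol under the frequency shift** (the datum `εΦ` of `klph_exchangeRow_diag_le_of_moduli`): for the STEP's member symbol
`Φ_j(t) = s_{n+1,j} + (w_{Λₙ₊₁} − w_{Λ(t)}) = klPhi Λ_j Λ(t)(ω² + e²)` (`0 < Λ_j ≤ Λ(t)`), on the hard shell at `Λ(t)` with `|ω_ν′ − ω_p| ≤ q₀`, `0 ≤ q₀`, `8q₀ ≤ Λ(t)`: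
`|Φ_j(t)(ν′, k̃_p) − Φ_j(t)(p)| ≤ (128/Λ(t)²)·(q₀·(2Λ(t) + q₀))`. -/
theorem klph_memberSymbol_shift_le (β μ : ℝ) (K : TrigPolyC4v) (n j : ℕ) {Λ : ℝ} (hΛj : 0 < klScale klE0 j) (hle : klScale klE0 j ≤ Λ)
    {p : FreqMomentum L M} (hp : deriv (fun Λ' : ℝ => hubbardCutoffWeightCT L M β μ K Λ' p) Λ ≠ 0) {ν' : MatsubaraIdx M} {q₀ : ℝ} (hq₀ : 0 ≤ q₀)
    (hq : |matsubaraFreq β M ν' - matsubaraFreq β M p.1| ≤ q₀) (h8 : 8 * q₀ ≤ Λ) :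
    |(softSymbolCompl L M β μ K (n + 1) j (ν', p.2) +
          (hubbardCutoffWeightCT L M β μ K (klScale klE0 (n + 1)) (ν', p.2) - hubbardCutoffWeightCT L M β μ K Λ (ν', p.2))) -
        (softSymbolCompl L M β μ K (n + 1) j p + (hubbardCutoffWeightCT L M β μ K (klScale klE0 (n + 1)) p - hubbardCutoffWeightCT L M β μ K Λ p))| ≤
      128 / Λ ^ 2 * (q₀ * (2 * Λ + q₀)) := by
  have hΛ : 0 < Λ := hΛj.trans_le hle
  rw [klfw_memberSymbol_eq β μ K n j Λ (ν', p.2), klfw_memberSymbol_eq β μ K n j Λ p]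
  obtain ⟨hlo, hhi⟩ := klph_shell_of_derivWeight_ne_zero β μ K hΛ.ne' hp
  have hs' := klph_shift_sq_ge_of_shell β μ K hΛ hp hq h8
  have h := klph_klPhi_local_lipschitz hΛj hle hlo hs'
  refine h.trans (mul_le_mul_of_nonneg_left ?_ (by positivity))
  -- `|ω′² − ω²| = |ω′ − ω|·|ω′ + ω| ≤ q₀·(2Λ + q₀)` since `|ω| ≤ Λ` on the shell
  set ω := matsubaraFreq β M p.1
  set ω' := matsubaraFreq β M ν'
  have hωΛ : |ω| ≤ Λ := by
    rw [← Real.sqrt_sq hΛ.le, ← Real.sqrt_sq_eq_abs]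
    exact Real.sqrt_le_sqrt (by nlinarith [sq_nonneg (nambuXiCT L μ K p.2)])
  have hsum : |ω' + ω| ≤ 2 * Λ + q₀ := by
    calc |ω' + ω| = |(ω' - ω) + 2 * ω| := by ring_nf
      _ ≤ |ω' - ω| + |2 * ω| := abs_add_le _ _
      _ ≤ q₀ + 2 * Λ := by rw [abs_mul, abs_two]; linarith
      _ = 2 * Λ + q₀ := by ring
  calc |ω' ^ 2 + nambuXiCT L μ K p.2 ^ 2 - (ω ^ 2 + nambuXiCT L μ K p.2 ^ 2)| = |ω' - ω| * |ω' + ω| := by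
        rw [← abs_mul]; congr 1; ring
    _ ≤ q₀ * (2 * Λ + q₀) := mul_le_mul hq hsum (abs_nonneg _) hq₀

/-! ## §3 The hard-shell count -/

section Count

variable {R : RenConsts} {U : ℝ} {N : ℕ}

omit [NeZero M] in
/-- **The hard-shell count** (the datum `N_sh` of `klph_exchangeRow_diag_le_of_moduli`): on an admissible frame with `L ≥ 2¹⁵`, `1 ≤ n`, `0 < β`, for the STEP's hard line at
`Λ(t) ∈ (0, Λₙ]`: `#{p : Ẇ_t(p) ≠ 0} ≤ (Λ(t)β/π + 1)·(2200·(4Λₙ)·L² + 200000·L)`. -/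
theorem klph_card_hardShell_le {β μ : ℝ} {K : TrigPolyC4v} (hK : FrameOK R U N μ K) (hL : (2 : ℝ) ^ 15 ≤ L) (hβ : 0 < β) {n : ℕ} (hn : 1 ≤ n)
    {Λ : ℝ} (hΛ : 0 < Λ) (hΛn : Λ ≤ klScale klE0 n) :
    ((univ.filter fun p : FreqMomentum L M => deriv (fun Λ' : ℝ => hubbardCutoffWeightCT L M β μ K Λ' p) Λ ≠ 0).card : ℝ) ≤
      (Λ * β / π + 1) * (2200 * (4 * klScale klE0 n) * (L : ℝ) ^ 2 + 200000 * L) := by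
  classical
  -- the support of `Ẇ_Λ` sits in the disc `ω² + e² ≤ Λ²`
  have hsub : (univ.filter fun p : FreqMomentum L M => deriv (fun Λ' : ℝ => hubbardCutoffWeightCT L M β μ K Λ' p) Λ ≠ 0) ⊆
      univ.filter fun p : FreqMomentum L M => matsubaraFreq β M p.1 ^ 2 + nambuXiCT L μ K p.2 ^ 2 ≤ Λ ^ 2 ∧ True := by
    intro p hp
    exact mem_filter.mpr ⟨mem_univ _, (klph_shell_of_derivWeight_ne_zero β μ K hΛ.ne' (mem_filter.mp hp).2).2, trivial⟩
  have h1 : ((univ.filter fun p : FreqMomentum L M => deriv (fun Λ' : ℝ => hubbardCutoffWeightCT L M β μ K Λ' p) Λ ≠ 0).card : ℝ) ≤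
      ((univ.filter fun p : FreqMomentum L M => matsubaraFreq β M p.1 ^ 2 + nambuXiCT L μ K p.2 ^ 2 ≤ Λ ^ 2 ∧ True).card : ℝ) := by
    exact_mod_cast Finset.card_le_card hsub
  have h2 := card_disc_filter_le_sharp (L := L) (M := M) hβ μ K hΛ.le (fun _ : TorusSite 2 L => True)
  -- the momentum shell `|e| ≤ Λ ≤ Λₙ < 4Λₙ`
  have h3 : ((univ.filter fun k : TorusSite 2 L => |nambuXiCT L μ K k| ≤ Λ ∧ True).card : ℝ) ≤
      ((univ.filter fun k : TorusSite 2 L => |nambuXiCT L μ K k| < 4 * klScale klE0 n).card : ℝ) := by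
    have hΛn' : Λ < 4 * klScale klE0 n := by linarith [klth_klScale_pos n]
    refine Nat.cast_le.mpr (Finset.card_le_card fun k hk => ?_)
    have h := (Finset.mem_filter.mp hk).2.1
    exact Finset.mem_filter.mpr ⟨Finset.mem_univ _, h.trans_lt hΛn'⟩
  have h4 := klzf_card_shell_le L hK hL hn
  have hfac : 0 ≤ Λ * β / π + 1 := by positivity
  calc ((univ.filter fun p : FreqMomentum L M => deriv (fun Λ' : ℝ => hubbardCutoffWeightCT L M β μ K Λ' p) Λ ≠ 0).card : ℝ)
      ≤ (Λ * β / π + 1) * ((univ.filter fun k : TorusSite 2 L => |nambuXiCT L μ K k| ≤ Λ ∧ True).card : ℝ) := h1.trans h2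
    _ ≤ (Λ * β / π + 1) * (2200 * (4 * klScale klE0 n) * (L : ℝ) ^ 2 + 200000 * L) := mul_le_mul_of_nonneg_left (h3.trans h4) hfac

end Count

end Summit.HubbardSuperconductivity.HubbardSuperconductivity.Theorems.KLRegimeSplit

end
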